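import Summits.AtomisticToContinuum.FouriersLaw.Theses.BondHeatUncertainty
import Summits.AtomisticToContinuum.FouriersLaw.Theses.JunctionLocality
import Summits.AtomisticToContinuum.FouriersLaw.Theorems.BondHeatUncertaintyTransferToNonBallistic
import Summits.AtomisticToContinuum.FouriersLaw.Theorems.BondHeatUncertaintyLinearResponseFTUR
import Summits.AtomisticToContinuum.FouriersLaw.Theorems.BondHeatUncertaintySubdiffusiveBondHeatIffBoundedResponse
import Summits.AtomisticToContinuum.FouriersLaw.Theorems.OddSectorIrreversibilityBoundedResponseConvergesStubPositiveConductance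
import Summits.AtomisticToContinuum.FouriersLaw.Theorems.EmbeddedDrudeMourreNessUnique

/-!
# Crux-strategist r1 — typed census artefacts for crux stmt-AtomisticToContinuum-9120 `SubdiffusiveBondHeat` (S)

Companion of `Cruxes/SubdiffusiveBondHeat/STRATEGY-CENSUS.md` (r1).  Everything is stated over tree vocabulary; no `sorry`.

§1 (Decomposition D12, ASSEMBLY PROVED).  `(S) ⟸ LightConeBondHeat (9123) ∧ ExtensiveSnapshotIrreversibility (9121) ∧
   JunctionLocality.SuperadditiveResistance (11748) ∧ TransientEW` — four EXISTING / typed pieces, glue from landed theorems only: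
   * `bddAbove_abs_of_superadditive_nonBallistic` — abstract Fekete-lite: positivity, superadditivity of `R_N − C` and
     non-ballisticity give bounded `|D_N|` (no lower bound `D_N ≥ c` needed, unlike `SuperadditiveFekete`);
   * `boundedResponse_of_superadditiveResistance_nonBallistic` — (A) 11748 ∧ (B) 9127 ⟹ `BoundedResponse` (11071);
   * `boundedResponse_of_lightCone_K_superadditive` — 9123 ∧ 9121 ∧ 11748 ⟹ 11071 (light-cone rung 9656 + (★) 9122 + 0741, proved);
   * `subdiffusiveBondHeat_of_lightCone_K_superadditive_transientEW` — the D12 assembly, through p152330's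
     `subdiffusiveBondHeat_of_boundedResponse_transientEW`.
   Reading: the Ohm factor of (S) is supplied by the route's OWN light-cone rung plus the sibling crux 11748; what is left of (S) is the
   Ohm-free contact transient `TransientEW`, which `closes` never uses — so the productive form of D12 is the route-level re-pointing
   certified in `glue-repoint.lean` (`closes_repointed`), not a `route edit --split`.

§2 (Strengthen S⁺_J, REDUCTION PROVED).  `IncrementAntipersistence`: scale-by-scale anti-persistence of the bond heat,
   `V_N(b,2t) ≤ √2·V_N(b,t)` for `t ∈ [1/2, cN²/2]`, plus an `O(1)` bound on `[1/2,1]`; `subdiffusiveBondHeat_of_incrementAntipersistence`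
   derives (S) by dyadic induction (`dyadic_sqrt_bound`).  It is the renormalisable ("strengthen-to-induct") form of (S); the census explains
   why the induction step is the crux at each scale (no mechanism produces the anticorrelation except diffusive relaxation itself).
-/

noncomputable section

open MeasureTheory Filter Topology Set

namespace Summit.AtomisticToContinuum.FouriersLaw.Cruxes.SubdiffusiveBondHeat.StrategistR1

open Literature.MathematicalPhysics.KineticTheory.HeatConduction
open Summit.AtomisticToContinuum.FouriersLaw.Theses.BondHeatUncertainty
  (SubdiffusiveBondHeat LightConeBondHeat ExtensiveSnapshotIrreversibility NonBallistic BoundedResponse)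
open Summit.AtomisticToContinuum.FouriersLaw.Theses.JunctionLocality (SuperadditiveResistance)

/-! ## §1 Fekete-lite and the D12 assembly -/

/-- Linear growth of a sequence superadditive on `{N ≥ 2}` from ONE good scale `N₀` (`a N₀ ≥ 1`), along the Euclidean
decomposition `k·N₀ + r`, `2 ≤ r < N₀ + 2`. [folklore] -/
theorem superadditive_growth {a : ℕ → ℝ} {N₀ : ℕ} (hN₀ : 2 ≤ N₀)
    (hsup : ∀ N M : ℕ, 2 ≤ N → 2 ≤ M → a N + a M ≤ a (N + M)) (hgood : 1 ≤ a N₀)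
    {B : ℝ} (hB : ∀ r : ℕ, 2 ≤ r → r < N₀ + 2 → -B ≤ a r) :
    ∀ k r : ℕ, 2 ≤ r → r < N₀ + 2 → (k : ℝ) - B ≤ a (k * N₀ + r) := by
  intro k
  induction k with
  | zero =>
      intro r hr hr'
      simpa using hB r hr hr'
  | succ k ih =>
      intro r hr hr'
      have h1 := ih r hr hr'
      have h2 : 2 ≤ k * N₀ + r := le_add_left hr
      have h3 := hsup N₀ (k * N₀ + r) hN₀ h2
      have heq : N₀ + (k * N₀ + r) = (k + 1) * N₀ + r := by ring
      rw [heq] at h3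
      push_cast
      linarith

/-- **Fekete-lite (abstract): positivity + junction superadditivity + non-ballisticity ⟹ bounded response.**
With `R_N := (N−1)/D_N` and `a_N := R_N − C` superadditive on `{N ≥ 2}`, one non-ballistic length `N₀` (`R_{N₀} ≥ |C| + 2`) forces
`R_M ≥ M/(2N₀)` for all large `M`, i.e. `0 < D_M ≤ 2N₀` eventually. No Ohmic LOWER bound is used. [folklore] -/
theorem bddAbove_abs_of_superadditive_nonBallistic {D : ℕ → ℝ} {C : ℝ}
    (hpos : ∀ N : ℕ, 2 ≤ N → 0 < D N)
    (hsup : ∀ N M : ℕ, 2 ≤ N → 2 ≤ M →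
      ((N : ℝ) - 1) / D N + ((M : ℝ) - 1) / D M - C ≤ ((N : ℝ) + (M : ℝ) - 1) / D (N + M))
    (hnb : ∀ ε : ℝ, 0 < ε → ∀ N₀ : ℕ, ∃ N : ℕ, N₀ ≤ N ∧ D N ≤ ε * ((N : ℝ) - 1)) :
    BddAbove (Set.range fun N : ℕ => |D N|) := by
  -- the superadditive sequence
  set a : ℕ → ℝ := fun N => ((N : ℝ) - 1) / D N - C with ha
  have hsup' : ∀ N M : ℕ, 2 ≤ N → 2 ≤ M → a N + a M ≤ a (N + M) := by
    intro N M hN hM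
    have h := hsup N M hN hM
    simp only [ha]
    push_cast
    linarith
  -- one good scale from non-ballisticity
  have hε : 0 < 1 / (|C| + 2) := by positivity
  obtain ⟨N₀, hN₀, hD₀⟩ := hnb (1 / (|C| + 2)) hε 2
  have hD₀pos := hpos N₀ hN₀
  have hR₀ : |C| + 2 ≤ ((N₀ : ℝ) - 1) / D N₀ := by
    rw [le_div_iff₀ hD₀pos]
    have : D N₀ * (|C| + 2) ≤ (N₀ : ℝ) - 1 := by
      have h := hD₀
      rw [div_mul_eq_mul_div, one_mul, le_div_iff₀ (by positivity : (0:ℝ) < |C| + 2)] at h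
      exact h
    linarith
  have hgood : 1 ≤ a N₀ := by
    simp only [ha]
    linarith [le_abs_self C, hR₀]
  -- a lower bound on the first period
  have hB : ∀ r : ℕ, 2 ≤ r → r < N₀ + 2 → -|C| ≤ a r := by
    intro r hr _
    simp only [ha]
    have : 0 ≤ ((r : ℝ) - 1) / D r := by
      apply div_nonneg _ (hpos r hr).le
      have : (2 : ℝ) ≤ r := by exact_mod_cast hr
      linarith
    linarith [le_abs_self C]
  have hgrowth := superadditive_growth hN₀ hsup' hgood hB
  -- every M ≥ 2 decomposes as k·N₀ + r with 2 ≤ r < N₀ + 2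
  have hdecomp : ∀ M : ℕ, 2 ≤ M → ((M : ℝ) - N₀ - 1) / N₀ - |C| ≤ a M := by
    intro M hM
    have hN₀pos : 0 < N₀ := by omega
    obtain ⟨k, r, hMr, hr2, hrlt⟩ : ∃ k r : ℕ, M = k * N₀ + r ∧ 2 ≤ r ∧ r < N₀ + 2 := by
      refine ⟨(M - 2) / N₀, (M - 2) % N₀ + 2, ?_, by omega, ?_⟩
      · have h1 := Nat.div_add_mod (M - 2) N₀
        have h2 : (M - 2) / N₀ * N₀ = N₀ * ((M - 2) / N₀) := Nat.mul_comm _ _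
        omega
      · have := Nat.mod_lt (M - 2) hN₀pos
        omega
    have hg := hgrowth k r hr2 hrlt
    rw [← hMr] at hg
    -- k ≥ (M - N₀ - 1)/N₀ as reals
    have hkR : ((M : ℝ) - N₀ - 1) / N₀ ≤ k := by
      have hN₀R : (0 : ℝ) < N₀ := by exact_mod_cast hN₀pos
      rw [div_le_iff₀ hN₀R]
      have h1 : (M : ℝ) = (k : ℝ) * N₀ + r := by exact_mod_cast hMr
      have hrle : r ≤ N₀ + 1 := by omega
      have h2 : (r : ℝ) ≤ N₀ + 1 := by exact_mod_cast hrle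
      linarith
    linarith
  -- hence R_M ≥ M/(2N₀) and 0 < D_M ≤ 2N₀ for all large M
  have hN₀R : (0 : ℝ) < N₀ := by exact_mod_cast (show 0 < N₀ by omega)
  obtain ⟨M₁, hM₁⟩ : ∃ M₁ : ℕ, (2 : ℝ) * N₀ + 2 + 4 * N₀ * |C| ≤ M₁ := exists_nat_ge _
  have hev : ∀ M : ℕ, max M₁ 2 ≤ M → |D M| ≤ 2 * N₀ := by
    intro M hM
    have hM2 : 2 ≤ M := le_trans (le_max_right _ _) hM
    have hMM₁ : M₁ ≤ M := le_trans (le_max_left _ _) hM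
    have hMR : (M₁ : ℝ) ≤ M := by exact_mod_cast hMM₁
    have hDpos := hpos M hM2
    have ha' := hdecomp M hM2
    simp only [ha] at ha'
    -- N₀ · R_M ≥ M − N₀ − 1 − (|C| − C)·N₀, hence 2N₀·R_M ≥ M
    have hX1 : ((M : ℝ) - N₀ - 1) ≤ (((M : ℝ) - 1) / D M - C + |C|) * N₀ := by
      rw [← div_le_iff₀ hN₀R]
      linarith [ha']
    have hCC : (|C| - C) * (N₀ : ℝ) ≤ 2 * |C| * N₀ :=
      mul_le_mul_of_nonneg_right (by linarith [neg_abs_le C]) hN₀R.le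
    have hX : (M : ℝ) ≤ 2 * N₀ * (((M : ℝ) - 1) / D M) := by
      linarith [hX1, hCC, hM₁, hMR]
    have hX' : (M : ℝ) ≤ 2 * N₀ * ((M : ℝ) - 1) / D M := by
      rwa [mul_div_assoc]
    have h3 : (M : ℝ) * D M ≤ 2 * N₀ * ((M : ℝ) - 1) := (le_div_iff₀ hDpos).mp hX'
    rw [abs_of_pos hDpos]
    have hM0 : (0 : ℝ) < M := by
      have : (2 : ℝ) ≤ M := by exact_mod_cast hM2
      linarith
    by_contra hcon
    push Not at hcon
    have h4 : (M : ℝ) * (2 * N₀) < M * D M := mul_lt_mul_of_pos_left hcon hM0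
    nlinarith [h3, h4, hN₀R]
  have hbu : IsBoundedUnder (· ≤ ·) atTop (fun N : ℕ => |D N|) :=
    ⟨2 * N₀, eventually_atTop.2 ⟨max M₁ 2, hev⟩⟩
  rw [← Nat.cofinite_eq_atTop] at hbu
  exact hbu.bddAbove_range_of_cofinite

/-- **(A) ∧ (B) ⟹ BoundedResponse.**  Junction superadditivity (`JunctionLocality.SuperadditiveResistance`, stmt-11748) and
non-ballisticity (`NonBallistic`, stmt-9127 — the same item in both routes) give the shared waypoint `BoundedResponse` (stmt-11071),
with weak-NESS uniqueness (0741) and positive finite-`N` conductance (11750) discharged by their in-tree proofs. [folklore] -/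
theorem boundedResponse_of_superadditiveResistance_nonBallistic
    (hA : SuperadditiveResistance) (hB : NonBallistic) : BoundedResponse := by
  intro ω₂ lam β γ hω hl hβ hγ μ hμ T hT D hD
  have huniq := Summit.AtomisticToContinuum.FouriersLaw.Theorems.nessUnique_proof ω₂ lam β γ hω hl hβ hγ
  have hpos : ∀ N : ℕ, 2 ≤ N → 0 < D N :=
    Summit.AtomisticToContinuum.FouriersLaw.Cruxes.BoundedResponseConverges.TwoScaleGluingLogRigidity.Stubs.positiveConductance_holds
      ω₂ lam β γ hω hl hβ hγ huniq μ hμ T hT D hD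
  obtain ⟨C, hsup⟩ := hA ω₂ lam β γ hω hl hβ hγ huniq μ hμ T hT D hD hpos
  have hnb := hB ω₂ lam β γ hω hl hβ hγ huniq μ hμ T hT D hD
  exact bddAbove_abs_of_superadditive_nonBallistic hpos hsup hnb

/-- **Light-cone rung ∧ (A) ⟹ BoundedResponse.**  `LightConeBondHeat` (9123) ∧ `ExtensiveSnapshotIrreversibility` (9121) give
`NonBallistic` by the proved transfer 9656 (engine (★) 9122 and uniqueness 0741 proved); then the previous theorem. -/
theorem boundedResponse_of_lightCone_K_superadditive (hLC : LightConeBondHeat) (hK : ExtensiveSnapshotIrreversibility)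
    (hA : SuperadditiveResistance) : BoundedResponse :=
  boundedResponse_of_superadditiveResistance_nonBallistic hA
    (Summit.AtomisticToContinuum.FouriersLaw.Theorems.transferToNonBallistic_proof hLC hK
      Summit.AtomisticToContinuum.FouriersLaw.Theorems.LinearResponseFTUR_proof
      Summit.AtomisticToContinuum.FouriersLaw.Theorems.nessUnique_proof)

/-- **D12 ASSEMBLY (proved): `9123 → 9121 → 11748 → TransientEW → (S)`.**  The fourth hypothesis is VERBATIM the Ohm-free
Edwards–Wilkinson transient of p138777 / p152330 (`∫₀ᵗ(1 − θ_N(s) − E_N) ds ≤ C₂√t` on `[1, cN²]`); the composition is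
p152330's `subdiffusiveBondHeat_of_boundedResponse_transientEW` fed with `boundedResponse_of_lightCone_K_superadditive`.
Honest split (no piece gives (S) or `FouriersLaw` alone), NOT filed: the fourth piece is dead weight for `closes`. -/
theorem subdiffusiveBondHeat_of_lightCone_K_superadditive_transientEW
    (hLC : LightConeBondHeat) (hK : ExtensiveSnapshotIrreversibility) (hA : SuperadditiveResistance)
    (hT : ∀ ω₂ lam β γ : ℝ, 0 < ω₂ → 0 < lam → 0 < β → 0 < γ → ∀ T : ℝ, 0 < T →
      ∃ C₂ c : ℝ, 0 < c ∧ ∃ N₀ : ℕ, ∀ N : ℕ, N₀ ≤ N → ∀ t : ℝ, 1 ≤ t → t ≤ c * (N : ℝ) ^ 2 →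
        (∫ s in (0 : ℝ)..t,
          (1 - γ / T ^ 2 * (∫ u in (0 : ℝ)..s,
              if h : 0 < N then
                ∫ z, ((z.2 ⟨0, h⟩) ^ 2 - T) *
                    (∫ y, ((y.2 ⟨0, h⟩) ^ 2 - T)
                      ∂((pinnedChain ω₂ lam β γ).transitionKernel N T T u.toNNReal z))
                  ∂((pinnedChain ω₂ lam β γ).gibbsMeasure N T)
              else 0) -
            (1 - γ / T ^ 2 * (∫ u in Set.Ioi (0 : ℝ),
              if h : 0 < N then
                ∫ z, ((z.2 ⟨0, h⟩) ^ 2 - T) *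
                    (∫ y, ((y.2 ⟨0, h⟩) ^ 2 - T)
                      ∂((pinnedChain ω₂ lam β γ).transitionKernel N T T u.toNNReal z))
                  ∂((pinnedChain ω₂ lam β γ).gibbsMeasure N T)
              else 0)))) ≤ C₂ * Real.sqrt t) :
    SubdiffusiveBondHeat :=
  Summit.AtomisticToContinuum.FouriersLaw.Theorems.SubdiffusiveBondHeat.subdiffusiveBondHeat_of_boundedResponse_transientEW
    (boundedResponse_of_lightCone_K_superadditive hLC hK hA) hT

/-! ## §2 Strengthen S⁺_J: scale-by-scale anti-persistence -/

/-- Dyadic induction: an `O(1)` bound on `[1/2, 1]` and the doubling law `V(2t) ≤ √2·V(t)` on `[1/2, L/2]` give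
`V(t) ≤ √2·A₀·√t` on `[1, L]`. [folklore] -/
theorem dyadic_sqrt_bound {V : ℝ → ℝ} {A₀ L : ℝ} (hA₀ : 0 ≤ A₀)
    (h0 : ∀ t : ℝ, 1 / 2 ≤ t → t ≤ 1 → V t ≤ A₀)
    (hstep : ∀ t : ℝ, 1 / 2 ≤ t → 2 * t ≤ L → V (2 * t) ≤ Real.sqrt 2 * V t) :
    ∀ t : ℝ, 1 ≤ t → t ≤ L → V t ≤ Real.sqrt 2 * A₀ * Real.sqrt t := by
  have hs2 : 0 ≤ Real.sqrt 2 := Real.sqrt_nonneg 2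
  -- claim along dyadic scales
  have claim : ∀ k : ℕ, ∀ s : ℝ, 1 / 2 ≤ s → s ≤ 1 → (2 : ℝ) ^ k * s ≤ L →
      V ((2 : ℝ) ^ k * s) ≤ A₀ * Real.sqrt 2 ^ k := by
    intro k
    induction k with
    | zero =>
        intro s hs hs1 _
        simpa using h0 s hs hs1
    | succ k ih =>
        intro s hs hs1 hL
        have hpow : (1 : ℝ) ≤ (2 : ℝ) ^ k := one_le_pow₀ (by norm_num)
        have ht : 1 / 2 ≤ (2 : ℝ) ^ k * s := by nlinarith
        have h2t : 2 * ((2 : ℝ) ^ k * s) ≤ L := by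
          have e : (2 : ℝ) ^ (k + 1) * s = 2 * ((2 : ℝ) ^ k * s) := by ring
          linarith [e, hL]
        have hkL : (2 : ℝ) ^ k * s ≤ L := by linarith [h2t, ht]
        have h1 := hstep ((2 : ℝ) ^ k * s) ht h2t
        have h2 := ih s hs hs1 hkL
        have h3 : Real.sqrt 2 * V ((2 : ℝ) ^ k * s) ≤ Real.sqrt 2 * (A₀ * Real.sqrt 2 ^ k) :=
          mul_le_mul_of_nonneg_left h2 hs2
        have heq : (2 : ℝ) ^ (k + 1) * s = 2 * ((2 : ℝ) ^ k * s) := by ring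
        rw [heq]
        calc V (2 * ((2 : ℝ) ^ k * s)) ≤ Real.sqrt 2 * V ((2 : ℝ) ^ k * s) := h1
          _ ≤ Real.sqrt 2 * (A₀ * Real.sqrt 2 ^ k) := h3
          _ = A₀ * Real.sqrt 2 ^ (k + 1) := by ring
  intro t ht htL
  obtain ⟨n, hn, hn'⟩ := exists_nat_pow_near ht (by norm_num : (1 : ℝ) < 2)
  -- t = 2^(n+1) * s with s ∈ [1/2, 1)
  have hpos : (0 : ℝ) < (2 : ℝ) ^ (n + 1) := by positivity
  set s : ℝ := t / (2 : ℝ) ^ (n + 1) with hs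
  have hts : (2 : ℝ) ^ (n + 1) * s = t := by
    rw [hs]; field_simp
  have hs_lo : 1 / 2 ≤ s := by
    rw [hs, le_div_iff₀ hpos]
    have : (2 : ℝ) ^ (n + 1) = 2 * 2 ^ n := by ring
    rw [this]; linarith
  have hs_hi : s ≤ 1 := by
    rw [hs, div_le_one hpos]; exact hn'.le
  have hc := claim (n + 1) s hs_lo hs_hi (by rw [hts]; exact htL)
  rw [hts] at hc
  -- √2^(n+1) = √2 · √2^n and √2^n ≤ √t
  have hsq : Real.sqrt 2 ^ n ≤ Real.sqrt t := by
    have key : (Real.sqrt 2 ^ n) ^ 2 ≤ t := by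
      calc (Real.sqrt 2 ^ n) ^ 2 = (Real.sqrt 2 ^ 2) ^ n := by ring
        _ = (2 : ℝ) ^ n := by rw [Real.sq_sqrt (by norm_num : (0:ℝ) ≤ 2)]
        _ ≤ t := hn
    calc Real.sqrt 2 ^ n = Real.sqrt ((Real.sqrt 2 ^ n) ^ 2) := by rw [Real.sqrt_sq (pow_nonneg hs2 n)]
      _ ≤ Real.sqrt t := Real.sqrt_le_sqrt key
  calc V t ≤ A₀ * Real.sqrt 2 ^ (n + 1) := hc
    _ = Real.sqrt 2 * A₀ * Real.sqrt 2 ^ n := by ring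
    _ ≤ Real.sqrt 2 * A₀ * Real.sqrt t := by
        apply mul_le_mul_of_nonneg_left hsq
        exact mul_nonneg hs2 hA₀

/-- **S⁺_J — IncrementAntipersistence** (strengthen-to-induct form of (S); census r1 §Strengthen).  Same objects `C`, `V` as (S),
verbatim.  For every parameter point: some `A₀`, `c > 0`, `N₀` such that every `N ≥ N₀` has a bond `b` with (i) `V_N(b,t) ≤ A₀`
on `[1/2, 1]` (statics: `V ≤ 2⟨j_b²⟩t²`) and (ii) the DOUBLING LAW `V_N(b,2t) ≤ √2·V_N(b,t)` for `1/2 ≤ t`, `2t ≤ cN²` — equivalently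
the covariance of successive heat increments satisfies `Cov(Q_[0,t], Q_[t,2t]) ≤ −(1 − 1/√2)·Var(Q_[0,t])` at every scale below the
Thouless time (fBM-¼ anti-persistence).  FALSE for phonons (`V ∝ t` there). -/
def IncrementAntipersistence : Prop :=
  ∀ ω₂ lam β γ : ℝ, 0 < ω₂ → 0 < lam → 0 < β → 0 < γ → ∀ T : ℝ, 0 < T →
    (let P := Literature.MathematicalPhysics.KineticTheory.HeatConduction.pinnedChain ω₂ lam β γ
     let C : ℕ → ℕ → ℝ → ℝ := fun N b s => if h : b < N then ∫ z, P.bondCurrent N ⟨b, h⟩ z *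
       (∫ y, P.bondCurrent N ⟨b, h⟩ y ∂(P.transitionKernel N T T s.toNNReal z)) ∂(P.gibbsMeasure N T) else 0
     let V : ℕ → ℕ → ℝ → ℝ := fun N b t => 2 * ∫ s in (0 : ℝ)..t, (t - s) * C N b s
     ∃ A₀ c : ℝ, 0 < c ∧ ∃ N₀ : ℕ, ∀ N : ℕ, N₀ ≤ N → ∃ b : ℕ, b + 1 < N ∧
       (∀ t : ℝ, 1 / 2 ≤ t → t ≤ 1 → V N b t ≤ A₀) ∧
       (∀ t : ℝ, 1 / 2 ≤ t → 2 * t ≤ c * (N : ℝ) ^ 2 → V N b (2 * t) ≤ Real.sqrt 2 * V N b t))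

/-- **S⁺_J ⟹ (S)** by dyadic induction (`dyadic_sqrt_bound`), with `A := √2·max A₀ 0`. -/
theorem subdiffusiveBondHeat_of_incrementAntipersistence : IncrementAntipersistence → SubdiffusiveBondHeat := by
  intro h ω₂ lam β γ hω hl hβ hγ T hT
  have h' := h ω₂ lam β γ hω hl hβ hγ T hT
  dsimp only at h' ⊢
  obtain ⟨A₀, c, hc, N₀, hN⟩ := h'
  refine ⟨Real.sqrt 2 * max A₀ 0, c, hc, N₀, fun N hNN => ?_⟩
  obtain ⟨b, hb, h0, hstep⟩ := hN N hNN
  refine ⟨b, hb, fun t ht htc => ?_⟩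
  exact dyadic_sqrt_bound (le_max_right A₀ 0) (fun u hu hu1 => (h0 u hu hu1).trans (le_max_left A₀ 0)) hstep t ht htc

end Summit.AtomisticToContinuum.FouriersLaw.Cruxes.SubdiffusiveBondHeat.StrategistR1

end
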